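import Mathlib.RingTheory.Artinian.Ring
import Mathlib.RingTheory.Idempotents
import Mathlib.RingTheory.Ideal.GoingUp
import Mathlib.RingTheory.Ideal.Over
import Mathlib.RingTheory.LocalRing.MaximalIdeal.Basic
import Mathlib.RingTheory.Finiteness.Quotient
import Mathlib.Algebra.BigOperators.Pi
import HarnessLib

/-!
# Module-finite algebras over a local ring: idempotents, and the decomposition into local factors when idempotents lift
# ([StacksProject] Tag 04GG (10.153.3–10.153.4); Milne, *Étale Cohomology*, I §4 Thm. 4.2)

Topic `Literature/RingTheory/Idempotents`.  THEOREMS only (no def, no instance, no notation, no named fact, no `sorry`).  Cell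
`hodgecm-mathlib` (D-0151), FLOOR 0, programme F0P5a, crux item stmt-HodgeConjecture-24832 — generic commutative-algebra capital (S-γ1) for
«specialisation of geometric fibres of a finite flat cover under the reduction map» (F0P5a LEAD WORD #11, MOD-PLAN row L5.5a).

Let `(R, 𝔪)` be a local ring and `A` a commutative `R`-algebra which is FINITE as an `R`-module; write `𝔪A := 𝔪.map (algebraMap R A)`.

* §1 Every maximal ideal of `A` contains `𝔪A` (`A` is integral over `R`); an element of `1 + 𝔪A` is a unit; an idempotent of `A` lying in `𝔪A`
  is `0`; two idempotents of `A` whose product lies in `𝔪A` are orthogonal; `A ⧸ 𝔪A` is an artinian ring and `A` has finitely many maximal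
  ideals, in bijection with those of `A ⧸ 𝔪A`.
* §2 In a commutative ARTINIAN ring `S` (for any `Fintype` structure on its finite maximal spectrum, e.g. `Fintype.ofFinite`) there is a complete
  orthogonal family of idempotents `e_I` indexed by the maximal ideals `I` with `1 - e_I ∈ I` and `e_I ∈ I'` for `I' ≠ I` (Chinese remainder
  modulo a vanishing power of the nilradical).
* §3 **If every idempotent of `A ⧸ 𝔪A` lifts to an idempotent of `A`** (the HENSELIAN property of the pair `(R, A)`; it holds for every finite
  `A` when `R` is henselian — [StacksProject 04GG] —, in particular when `R` is the valuation ring of an algebraically closed valued field, see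
  the sequel file) **then `A` carries a complete orthogonal family of idempotents `e_I`, indexed by the maximal ideals `I` of `A ⧸ 𝔪A`
  (equivalently of `A`), lifting the family of §2, and EVERY CORNER `A ⧸ (1 - e_I)` IS A LOCAL RING; hence `A ≅ Π_I A ⧸ (1 - e_I)` is a finite
  product of local rings** (`exists_completeOrthogonalIdempotents_isLocalRing_of_lift`, `bijective_pi_of_lift`).

HC_CM is proved only modulo the 7 printed citations until rung 0 closes; this file is a generic leaf and changes no count.

## References
* [StacksProject] The Stacks Project, Tag 04GG (Lemma 10.153.3: characterisations of henselian local rings; 10.153.4), Tag 00JA (artinian rings).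
* J. S. Milne, *Étale Cohomology*, Princeton 1980, Ch. I §4, Thm. 4.2 (finite algebras over henselian rings).
-/

set_option autoImplicit false

namespace Literature.RingTheory.Idempotents

open IsLocalRing

/-! ### §2 (stated first, used below) Idempotents of an artinian ring separating its maximal ideals -/

/-- In a commutative ARTINIAN ring `S` there is a complete orthogonal family of idempotents `e_I`, indexed by the maximal ideals, with
`1 - e_I ∈ I` and `e_I ∈ I'` for `I' ≠ I` (Chinese remainder theorem modulo the powers `Iⁿ⁺¹`, `n + 1` killing the nilradical; Mathlib
`IsArtinianRing.quotNilradicalPowEquivPi`). [cite: StacksProject, Tag 00JA (Lemma 10.53.5)] -/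
theorem _root_.IsArtinianRing.exists_completeOrthogonalIdempotents_mem {S : Type*} [CommRing S] [IsArtinianRing S]
    [Fintype (MaximalSpectrum S)] :
    ∃ e : MaximalSpectrum S → S, CompleteOrthogonalIdempotents e ∧ (∀ I, 1 - e I ∈ I.asIdeal) ∧
      ∀ I I', I ≠ I' → e I ∈ I'.asIdeal := by
  classical
  obtain ⟨n, hn⟩ := IsArtinianRing.isNilpotent_nilradical (R := S)
  have hm : nilradical S ^ (n + 1) = ⊥ := by rw [pow_succ, hn, Ideal.zero_eq_bot, Ideal.bot_mul]
  -- `S ≃ S ⧸ nil^(n+1) ≃ Π_I S ⧸ I^(n+1)`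
  let φ : S ≃ₐ[S] ∀ I : MaximalSpectrum S, S ⧸ I.asIdeal ^ (n + 1) :=
    ((AlgEquiv.quotientBot S S).symm.trans (Ideal.quotientEquivAlgOfEq S hm.symm)).trans
      (IsArtinianRing.quotNilradicalPowEquivPi S (n + 1))
  have hφ : ∀ (x : S) (I : MaximalSpectrum S), φ x I = Ideal.Quotient.mk (I.asIdeal ^ (n + 1)) x := fun x I => rfl
  -- the standard idempotents of the product
  let δ : MaximalSpectrum S → ∀ J : MaximalSpectrum S, S ⧸ J.asIdeal ^ (n + 1) :=
    fun I => @Pi.single (MaximalSpectrum S) (fun J => S ⧸ J.asIdeal ^ (n + 1)) _ _ I 1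
  have hδsame : ∀ I, δ I I = 1 := fun I => Pi.single_eq_same _ _
  have hδne : ∀ I J, J ≠ I → δ I J = 0 := fun I J h => Pi.single_eq_of_ne h _
  have hδ : CompleteOrthogonalIdempotents δ := by
    refine ⟨⟨fun I => ?_, fun I J hIJ => ?_⟩, ?_⟩
    · change δ I * δ I = δ I
      ext K
      rcases eq_or_ne K I with rfl | hKI
      · rw [Pi.mul_apply, hδsame, mul_one]
      · rw [Pi.mul_apply, hδne _ _ hKI, mul_zero]
    · change δ I * δ J = 0
      ext K
      rcases eq_or_ne K I with rfl | hKI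
      · rw [Pi.mul_apply, hδne J K hIJ, mul_zero, Pi.zero_apply]
      · rw [Pi.mul_apply, hδne I K hKI, zero_mul, Pi.zero_apply]
    · change ∑ I, δ I = 1
      exact Finset.univ_sum_single (1 : ∀ J : MaximalSpectrum S, S ⧸ J.asIdeal ^ (n + 1))
  refine ⟨fun I => φ.symm (δ I), ⟨⟨fun I => ?_, fun I J hIJ => ?_⟩, ?_⟩, ?_, ?_⟩
  · change φ.symm (δ I) * φ.symm (δ I) = φ.symm (δ I)
    rw [← map_mul, (hδ.idem I).eq]
  · change φ.symm (δ I) * φ.symm (δ J) = 0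
    rw [← map_mul, hδ.ortho hIJ, map_zero]
  · change ∑ I, φ.symm (δ I) = 1
    rw [← map_sum, hδ.complete, map_one]
  · intro I
    have hmem : 1 - φ.symm (δ I) ∈ I.asIdeal ^ (n + 1) := by
      rw [← Ideal.Quotient.eq_zero_iff_mem, ← hφ, map_sub, map_one, AlgEquiv.apply_symm_apply, Pi.sub_apply, Pi.one_apply, hδsame,
        sub_self]
    exact Ideal.pow_le_self (Nat.succ_ne_zero n) hmem
  · intro I I' hII'
    have hmem : φ.symm (δ I) ∈ I'.asIdeal ^ (n + 1) := by
      rw [← Ideal.Quotient.eq_zero_iff_mem, ← hφ, AlgEquiv.apply_symm_apply]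
      exact hδne I I' hII'.symm
    exact Ideal.pow_le_self (Nat.succ_ne_zero n) hmem

variable {R A : Type*} [CommRing R] [IsLocalRing R] [CommRing A] [Algebra R A] [Module.Finite R A]

/-! ### §1 Maximal ideals, units and idempotents of a finite algebra over a local ring -/

/-- Every maximal ideal of a module-finite algebra `A` over a local ring `(R, 𝔪)` contains `𝔪A` (its contraction to `R` is maximal, `A` being
integral over `R`). [cite: StacksProject, Tag 04GG (10.153.3)] -/
theorem map_maximalIdeal_le_of_isMaximal (𝔫 : Ideal A) (h𝔫 : 𝔫.IsMaximal) : (maximalIdeal R).map (algebraMap R A) ≤ 𝔫 := by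
  haveI : Algebra.IsIntegral R A := Algebra.IsIntegral.of_finite R A
  haveI := h𝔫
  rw [Ideal.map_le_iff_le_comap]
  have hc : (𝔫.comap (algebraMap R A)).IsMaximal := Ideal.isMaximal_comap_of_isIntegral_of_isMaximal 𝔫
  exact (IsLocalRing.eq_maximalIdeal hc).ge

/-- An element of `1 + 𝔪A` is a unit of `A`. [cite: StacksProject, Tag 04GG (10.153.3)] -/
theorem isUnit_one_sub_of_mem_map_maximalIdeal {x : A} (hx : x ∈ (maximalIdeal R).map (algebraMap R A)) : IsUnit (1 - x) := by
  by_contra h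
  obtain ⟨𝔫, h𝔫, hmem⟩ := exists_max_ideal_of_mem_nonunits (mem_nonunits_iff.mpr h)
  have hx' : x ∈ 𝔫 := map_maximalIdeal_le_of_isMaximal 𝔫 h𝔫 hx
  have h1 : (1 : A) ∈ 𝔫 := by simpa using 𝔫.add_mem hmem hx'
  exact h𝔫.ne_top ((Ideal.eq_top_iff_one 𝔫).mpr h1)

/-- An idempotent of `A` lying in `𝔪A` is zero. [cite: StacksProject, Tag 04GG (10.153.3)] -/
theorem eq_zero_of_isIdempotentElem_of_mem {e : A} (he : IsIdempotentElem e) (h : e ∈ (maximalIdeal R).map (algebraMap R A)) :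
    e = 0 := by
  obtain ⟨u, hu⟩ := isUnit_one_sub_of_mem_map_maximalIdeal h
  have h0 : (1 - e) * e = 0 := by rw [sub_mul, one_mul, he.eq, sub_self]
  calc e = ↑u⁻¹ * (↑u * e) := by rw [← mul_assoc, Units.inv_mul, one_mul]
    _ = 0 := by rw [hu, h0, mul_zero]

/-- An idempotent of `A` congruent to `1` modulo `𝔪A` is `1`. [cite: StacksProject, Tag 04GG (10.153.3)] -/
theorem eq_one_of_isIdempotentElem_of_one_sub_mem {e : A} (he : IsIdempotentElem e)
    (h : 1 - e ∈ (maximalIdeal R).map (algebraMap R A)) : e = 1 := by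
  have := eq_zero_of_isIdempotentElem_of_mem he.one_sub h
  rwa [sub_eq_zero, eq_comm] at this

/-- Two idempotents of `A` whose product lies in `𝔪A` are orthogonal. [cite: StacksProject, Tag 04GG (10.153.3)] -/
theorem mul_eq_zero_of_isIdempotentElem_of_mul_mem {e f : A} (he : IsIdempotentElem e) (hf : IsIdempotentElem f)
    (h : e * f ∈ (maximalIdeal R).map (algebraMap R A)) : e * f = 0 :=
  eq_zero_of_isIdempotentElem_of_mem (he.mul hf) h

/-- `A ⧸ 𝔪A` is module-finite over the residue field. [cite: StacksProject, Tag 04GG (10.153.3)] -/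
theorem finite_residue_quotient : Module.Finite (R ⧸ maximalIdeal R) (A ⧸ (maximalIdeal R).map (algebraMap R A)) :=
  Module.Finite.of_restrictScalars_finite R _ _

/-- `A ⧸ 𝔪A` is an artinian ring (a finite algebra over the residue field). [cite: StacksProject, Tag 04GG (10.153.3)] -/
theorem isArtinianRing_quotient : IsArtinianRing (A ⧸ (maximalIdeal R).map (algebraMap R A)) :=
  haveI := finite_residue_quotient (R := R) (A := A)
  haveI : IsArtinianRing (R ⧸ maximalIdeal R) := by
    letI := Ideal.Quotient.field (maximalIdeal R)
    infer_instance
  IsArtinianRing.of_finite (R ⧸ maximalIdeal R) _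

/-- The maximal ideals of `A` correspond to those of `A ⧸ 𝔪A`: `𝔫 ↦ 𝔫 / 𝔪A` is maximal. [cite: StacksProject, Tag 04GG (10.153.3)] -/
theorem isMaximal_map_mk (𝔫 : Ideal A) (h𝔫 : 𝔫.IsMaximal) :
    (𝔫.map (Ideal.Quotient.mk ((maximalIdeal R).map (algebraMap R A)))).IsMaximal := by
  haveI := h𝔫
  exact Ideal.IsMaximal.map_of_surjective_of_ker_le Ideal.Quotient.mk_surjective (by
    rw [Ideal.mk_ker]; exact map_maximalIdeal_le_of_isMaximal 𝔫 h𝔫)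

/-- … and `𝔫` is recovered as the contraction of `𝔫 / 𝔪A`. [cite: StacksProject, Tag 04GG (10.153.3)] -/
theorem comap_map_mk (𝔫 : Ideal A) (h𝔫 : 𝔫.IsMaximal) :
    (𝔫.map (Ideal.Quotient.mk ((maximalIdeal R).map (algebraMap R A)))).comap (Ideal.Quotient.mk _) = 𝔫 := by
  rw [Ideal.comap_map_of_surjective _ Ideal.Quotient.mk_surjective, ← RingHom.ker_eq_comap_bot, Ideal.mk_ker, sup_eq_left]
  exact map_maximalIdeal_le_of_isMaximal 𝔫 h𝔫

omit [Module.Finite R A] in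
/-- Conversely a maximal ideal of `A ⧸ 𝔪A` contracts to a maximal ideal of `A` … [cite: StacksProject, Tag 04GG (10.153.3)] -/
theorem isMaximal_comap_mk (I : Ideal (A ⧸ (maximalIdeal R).map (algebraMap R A))) (hI : I.IsMaximal) :
    (I.comap (Ideal.Quotient.mk _)).IsMaximal :=
  Ideal.comap_isMaximal_of_surjective _ Ideal.Quotient.mk_surjective (H := hI)

omit [Module.Finite R A] in
/-- … whose image is `I` again. [cite: StacksProject, Tag 04GG (10.153.3)] -/
theorem map_comap_mk (I : Ideal (A ⧸ (maximalIdeal R).map (algebraMap R A))) :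
    (I.comap (Ideal.Quotient.mk _)).map (Ideal.Quotient.mk ((maximalIdeal R).map (algebraMap R A))) = I :=
  Ideal.map_comap_of_surjective _ Ideal.Quotient.mk_surjective I

section
include R

/-- `A` has finitely many maximal ideals. [cite: StacksProject, Tag 04GG (10.153.3)] -/
theorem finite_maximalSpectrum : Finite (MaximalSpectrum A) := by
  haveI := isArtinianRing_quotient (R := R) (A := A)
  refine Finite.of_injective (fun 𝔫 : MaximalSpectrum A =>
    (⟨𝔫.asIdeal.map (Ideal.Quotient.mk ((maximalIdeal R).map (algebraMap R A))), isMaximal_map_mk (R := R) 𝔫.asIdeal 𝔫.isMaximal⟩ :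
      MaximalSpectrum (A ⧸ (maximalIdeal R).map (algebraMap R A)))) ?_
  intro 𝔫 𝔫' h
  have h' := congrArg (fun I : MaximalSpectrum (A ⧸ (maximalIdeal R).map (algebraMap R A)) => I.asIdeal.comap (Ideal.Quotient.mk _)) h
  dsimp only at h'
  rw [comap_map_mk (R := R) _ 𝔫.isMaximal, comap_map_mk (R := R) _ 𝔫'.isMaximal] at h'
  exact MaximalSpectrum.ext h'

end

/-! ### §3 Lifting idempotents from `A ⧸ 𝔪A`: the decomposition into local factors -/

/-- **Decomposition into local factors when idempotents lift.**  Let `A` be module-finite over the local ring `(R, 𝔪)` and suppose every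
idempotent of `A ⧸ 𝔪A` lifts to an idempotent of `A` (the henselian property of `(R, A)`).  Then there is a complete orthogonal family of
idempotents `e_I` of `A`, indexed by the maximal ideals `I` of `A ⧸ 𝔪A`, SEPARATING the maximal ideals (`1 - e_I ∈ I.comap mk`,
`e_I ∈ I'.comap mk` for `I' ≠ I`), and EVERY CORNER `A ⧸ (1 - e_I)` IS A LOCAL RING.  (Lifted idempotents are automatically orthogonal and
complete: products and `1 - Σ` are idempotents in `𝔪A`, hence `0`.) [cite: StacksProject, Tag 04GG (10.153.3–10.153.4)]
-/
theorem exists_completeOrthogonalIdempotents_isLocalRing_of_lift [Fintype (MaximalSpectrum (A ⧸ (maximalIdeal R).map (algebraMap R A)))]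
    (hlift : ∀ ē : A ⧸ (maximalIdeal R).map (algebraMap R A), IsIdempotentElem ē →
      ∃ e : A, IsIdempotentElem e ∧ Ideal.Quotient.mk _ e = ē) :
    ∃ e : MaximalSpectrum (A ⧸ (maximalIdeal R).map (algebraMap R A)) → A, CompleteOrthogonalIdempotents e ∧
      (∀ I, 1 - e I ∈ I.asIdeal.comap (Ideal.Quotient.mk _)) ∧ (∀ I I', I ≠ I' → e I ∈ I'.asIdeal.comap (Ideal.Quotient.mk _)) ∧
      ∀ I, IsLocalRing (A ⧸ Ideal.span {1 - e I}) := by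
  classical
  haveI := isArtinianRing_quotient (R := R) (A := A)
  obtain ⟨ē, hē, hē1, hē0⟩ :=
    IsArtinianRing.exists_completeOrthogonalIdempotents_mem (S := A ⧸ (maximalIdeal R).map (algebraMap R A))
  choose e he hemk using fun I => hlift (ē I) (hē.idem I)
  have hortho : OrthogonalIdempotents e := by
    refine ⟨he, fun I J hIJ => mul_eq_zero_of_isIdempotentElem_of_mul_mem (R := R) (he I) (he J) ?_⟩
    rw [← Ideal.Quotient.eq_zero_iff_mem, map_mul, hemk, hemk]
    exact hē.ortho hIJ
  have hcomplete : ∑ I, e I = 1 := by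
    have hs : IsIdempotentElem (∑ I, e I) := hortho.isIdempotentElem_sum
    apply eq_one_of_isIdempotentElem_of_one_sub_mem (R := R) hs
    rw [← Ideal.Quotient.eq_zero_iff_mem, map_sub, map_one, map_sum, Finset.sum_congr rfl (fun I _ => hemk I), hē.complete, sub_self]
  have hsep1 : ∀ I, 1 - e I ∈ I.asIdeal.comap (Ideal.Quotient.mk ((maximalIdeal R).map (algebraMap R A))) := fun I => by
    rw [Ideal.mem_comap, map_sub, map_one, hemk]; exact hē1 I
  have hsep0 : ∀ I I', I ≠ I' → e I ∈ I'.asIdeal.comap (Ideal.Quotient.mk ((maximalIdeal R).map (algebraMap R A))) := fun I I' h => by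
    rw [Ideal.mem_comap, hemk]; exact hē0 I I' h
  refine ⟨e, ⟨hortho, hcomplete⟩, hsep1, hsep0, fun I => ?_⟩
  -- the corner `A ⧸ (1 - e_I)` is local: its maximal ideals pull back to maximal ideals of `A` containing `1 - e_I`, and there is only one
  apply IsLocalRing.of_unique_max_ideal
  have hsurj : Function.Surjective (Ideal.Quotient.mk (Ideal.span {1 - e I})) := Ideal.Quotient.mk_surjective
  have h𝔫 : (I.asIdeal.comap (Ideal.Quotient.mk ((maximalIdeal R).map (algebraMap R A)))).IsMaximal := isMaximal_comap_mk (R := R) _ I.isMaximal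
  have hker : RingHom.ker (Ideal.Quotient.mk (Ideal.span {1 - e I})) ≤ I.asIdeal.comap (Ideal.Quotient.mk ((maximalIdeal R).map (algebraMap R A))) := by
    rw [Ideal.mk_ker, Ideal.span_le, Set.singleton_subset_iff]; exact hsep1 I
  haveI := h𝔫
  refine ⟨(I.asIdeal.comap (Ideal.Quotient.mk ((maximalIdeal R).map (algebraMap R A)))).map (Ideal.Quotient.mk (Ideal.span {1 - e I})),
    Ideal.IsMaximal.map_of_surjective_of_ker_le hsurj hker, fun M hM => ?_⟩
  -- `M' := M.comap mk` is a maximal ideal of `A` containing `1 - e I`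
  have hM' : (M.comap (Ideal.Quotient.mk (Ideal.span {1 - e I}))).IsMaximal := Ideal.comap_isMaximal_of_surjective _ hsurj (H := hM)
  have hcontains : 1 - e I ∈ M.comap (Ideal.Quotient.mk (Ideal.span {1 - e I})) := by
    rw [Ideal.mem_comap, Ideal.Quotient.eq_zero_iff_mem.mpr (Ideal.mem_span_singleton_self (1 - e I))]; exact M.zero_mem
  -- its reduction `J` is a maximal ideal of `A ⧸ 𝔪A`; it must be `I`, for otherwise `e I ∈ M'` and `1 ∈ M'`
  have hJI : (⟨(M.comap (Ideal.Quotient.mk (Ideal.span {1 - e I}))).map (Ideal.Quotient.mk ((maximalIdeal R).map (algebraMap R A))),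
      isMaximal_map_mk (R := R) _ hM'⟩ : MaximalSpectrum (A ⧸ (maximalIdeal R).map (algebraMap R A))) = I := by
    by_contra hJI
    have h1 : e I ∈ M.comap (Ideal.Quotient.mk (Ideal.span {1 - e I})) := by
      have h0 := hē0 I _ (Ne.symm hJI)
      change ē I ∈ (M.comap (Ideal.Quotient.mk (Ideal.span {1 - e I}))).map (Ideal.Quotient.mk ((maximalIdeal R).map (algebraMap R A))) at h0
      rw [← hemk, Ideal.mem_map_iff_of_surjective _ Ideal.Quotient.mk_surjective] at h0
      obtain ⟨x, hx, hxe⟩ := h0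
      rw [Ideal.Quotient.eq] at hxe
      have h2 := Ideal.sub_mem _ hx ((map_maximalIdeal_le_of_isMaximal (R := R) _ hM') hxe)
      rwa [sub_sub_cancel] at h2
    have : (1 : A) ∈ M.comap (Ideal.Quotient.mk (Ideal.span {1 - e I})) := by
      simpa using Ideal.add_mem _ hcontains h1
    exact hM'.ne_top ((Ideal.eq_top_iff_one _).mpr this)
  have hM'eq : M.comap (Ideal.Quotient.mk (Ideal.span {1 - e I})) = I.asIdeal.comap (Ideal.Quotient.mk ((maximalIdeal R).map (algebraMap R A))) := by
    have h := congrArg (fun K : MaximalSpectrum (A ⧸ (maximalIdeal R).map (algebraMap R A)) => K.asIdeal.comap (Ideal.Quotient.mk _)) hJI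
    dsimp only at h
    rw [comap_map_mk (R := R) _ hM'] at h
    exact h
  calc M = (M.comap (Ideal.Quotient.mk (Ideal.span {1 - e I}))).map (Ideal.Quotient.mk (Ideal.span {1 - e I})) :=
      (Ideal.map_comap_of_surjective _ hsurj M).symm
    _ = _ := by rw [hM'eq]

/-- **`A ≅ Π_I A ⧸ (1 - e_I)`, a finite product of LOCAL rings** (the idempotents of `exists_completeOrthogonalIdempotents_isLocalRing_of_lift`
with Mathlib `CompleteOrthogonalIdempotents.bijective_pi`). [cite: StacksProject, Tag 04GG (10.153.4)] -/
theorem bijective_pi_of_lift [Fintype (MaximalSpectrum (A ⧸ (maximalIdeal R).map (algebraMap R A)))]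
    (hlift : ∀ ē : A ⧸ (maximalIdeal R).map (algebraMap R A), IsIdempotentElem ē →
      ∃ e : A, IsIdempotentElem e ∧ Ideal.Quotient.mk _ e = ē) :
    ∃ e : MaximalSpectrum (A ⧸ (maximalIdeal R).map (algebraMap R A)) → A, CompleteOrthogonalIdempotents e ∧
      (∀ I, IsLocalRing (A ⧸ Ideal.span {1 - e I})) ∧
      Function.Bijective (RingHom.pi fun I => Ideal.Quotient.mk (Ideal.span {1 - e I})) := by
  obtain ⟨e, he, -, -, hloc⟩ := exists_completeOrthogonalIdempotents_isLocalRing_of_lift (R := R) (A := A) hlift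
  exact ⟨e, he, hloc, he.bijective_pi⟩

end Literature.RingTheory.Idempotents
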